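import Summits.CriticalPhenomena.PercolationContinuityZ3.Theorems.Transplant.FKConnectivityAllQForestAdjacentFan
import HarnessLib

/-!
# LOCALLY CONNECTED GRAPHS satisfy the square-free adjacent forest Rayleigh inequality at every adjacent pair

Support file (`--supports stmt-CriticalPhenomena-4575`), FK sub-lane `prim-bschramm-fk-1` (gen 22) of the post-continuity programme;
builds on p205010 (kernel theorem, internal audit signed; external expert review pending).  No definitions, no named facts, no sorries;
standard axioms.

THE NODE (`AdjForestRayleighNoSqOn`; conjecture `AdjForestRayleighNoSqPos`): in the uniform ordered two-forest partition `(A, B)` of the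
pairs of a finite graph, `#{ov, oy ∈ A} ≤ #{ov ∈ A, oy ∈ B}`.  A graph is LOCALLY CONNECTED when the link `G[N(o)]` of every vertex `o`
is connected.  By THE LOCALLY-CONNECTED THEOREM (`adjForestNoSq_top_of_linkReachable`, `…ForestAdjacentFan`) the node's inequality then
holds at every `(o; v, y)` of the top fibre: **`adjForestNoSq_top_of_locallyConnected`**.  This settles the node, at every adjacent pair,
for an infinite class far outside the no-`K₄`-minor world where coefficientwise Rayleigh is known for all pairs (Semple–Welsh): every
triangulation of a closed surface, every maximal planar graph on ≥ 4 vertices, every 2-connected chordal graph (minimal separators are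
cliques, so links are connected), every cone over a connected graph (`…ForestAdjacentCone`), squares of cycles, wheels.  The hypothesis is
stated pair by pair (`hloc`), so graphs that are locally connected only at some vertices get the conclusion at those vertices.
[cite: SempleWelsh2008, Conj. 1.1 (p. 2); Thm. 4.2 (p. 11)] [cite: Linusson2011, Prop. 2.6] [cite: Grimmett2006, §1.5 (p. 13)]
-/

noncomputable section

namespace Summit.CriticalPhenomena.PercolationContinuityZ3.Theorems
namespace FK

open Set Literature.Probability.LatticeModels Literature.Probability.Percolation
open scoped Classical symmDiff

variable {V : Type*} [Fintype V]

section LocallyConnected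

variable {Eg : BondConfig V}

/-- **The node at a locally connected vertex**: if every two neighbours `v ≠ y` of `o` are joined inside the link `G[N(o)]`, then for
all `v ≠ y`: `#(Fo ∩ {ov, oy ∈ ω}, Fo) ≤ #(Fo ∩ {ov ∈ ω}, Fo ∩ {oy ∈ ω})` on the top fibre `(Eg, ∅)` (pairs `ov`, `oy` absent from
`Eg`, or loops, make the left side vanish). [cite: SempleWelsh2008, Conj. 1.1 (p. 2)] [cite: Linusson2011, Prop. 2.6] -/
theorem adjForestNoSq_top_of_locallyConnectedAt (o : V)
    (hloc : ∀ v y, s(o, v) ∈ Eg → s(o, y) ∈ Eg → o ≠ v → o ≠ y → v ≠ y →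
      (openGraph {g ∈ Eg | ∀ w ∈ g, w ≠ o ∧ s(o, w) ∈ Eg}).Reachable v y)
    {v y : V} (hvy : v ≠ y) :
    fibreCount Eg ∅ (forestEv V ∩ {ω | s(o, v) ∈ ω ∧ s(o, y) ∈ ω}) (forestEv V) ≤
      fibreCount Eg ∅ (forestEv V ∩ {ω | s(o, v) ∈ ω}) (forestEv V ∩ {ω | s(o, y) ∈ ω}) := by
  -- loops
  by_cases hov : o = v
  · subst hov
    rw [fibreCount_eq_zero_of_forall _ _ _ _ fun ω _ hA _ =>
      not_mem_of_isForestCfg_of_isDiag hA.1 (Sym2.mk_isDiag_iff.2 rfl) hA.2.1]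
    exact Nat.zero_le _
  by_cases hoy : o = y
  · subst hoy
    rw [fibreCount_eq_zero_of_forall _ _ _ _ fun ω _ hA _ =>
      not_mem_of_isForestCfg_of_isDiag hA.1 (Sym2.mk_isDiag_iff.2 rfl) hA.2.2]
    exact Nat.zero_le _
  -- absent pairs
  by_cases he : s(o, v) ∈ Eg
  swap
  · rw [fibreCount_eq_zero_of_forall _ _ _ _ fun ω hω hA _ =>
      (mem_union_of_fibre hω hA.2.1).elim he (Set.notMem_empty _)]
    exact Nat.zero_le _
  by_cases hf : s(o, y) ∈ Eg
  swap
  · rw [fibreCount_eq_zero_of_forall _ _ _ _ fun ω hω hA _ =>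
      (mem_union_of_fibre hω hA.2.2).elim hf (Set.notMem_empty _)]
    exact Nat.zero_le _
  exact adjForestNoSq_top_of_linkReachable Eg hvy (hloc v y he hf hov hoy hvy)

/-- **LOCALLY CONNECTED GRAPHS**: if the link of every vertex of the finite simple graph `Eg` is connected (every two neighbours of
every vertex `o` are joined by a path of neighbours of `o`), then the square-free adjacent forest Rayleigh inequality holds at EVERY
`(o; v, y)`, `v ≠ y`: in the uniform ordered two-forest partition of `Eg`, any two adjacent pairs are negatively correlated.  Covers
triangulations of closed surfaces, maximal planar graphs, 2-connected chordal graphs, cones over connected graphs, wheels, squares of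
cycles. [cite: SempleWelsh2008, Conj. 1.1 (p. 2); Thm. 4.2 (p. 11)] [cite: Linusson2011, Prop. 2.6] -/
theorem adjForestNoSq_top_of_locallyConnected
    (hloc : ∀ o v y, s(o, v) ∈ Eg → s(o, y) ∈ Eg → o ≠ v → o ≠ y → v ≠ y →
      (openGraph {g ∈ Eg | ∀ w ∈ g, w ≠ o ∧ s(o, w) ∈ Eg}).Reachable v y)
    (o : V) {v y : V} (hvy : v ≠ y) :
    fibreCount Eg ∅ (forestEv V ∩ {ω | s(o, v) ∈ ω ∧ s(o, y) ∈ ω}) (forestEv V) ≤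
      fibreCount Eg ∅ (forestEv V ∩ {ω | s(o, v) ∈ ω}) (forestEv V ∩ {ω | s(o, y) ∈ ω}) :=
  adjForestNoSq_top_of_locallyConnectedAt o (hloc o) hvy

end LocallyConnected

end FK
end Summit.CriticalPhenomena.PercolationContinuityZ3.Theorems

end
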